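import Summits.ResolutionOfSingularities.ResolutionOfSingularities.Theorems.EquisingularLiftEquisingularLiftNatDirectionCentre
import Summits.ResolutionOfSingularities.ResolutionOfSingularities.Theorems.EquisingularLiftEquisingularLiftNatNonEquimultipleStrictTransform
import Summits.ResolutionOfSingularities.ResolutionOfSingularities.Theorems.EquisingularLiftEquisingularLiftNatCarrierDeltaRegular
import Literature.AlgebraicGeometry.Resolution.AdicCompletionRegular
import HarnessLib

/-!
# [OURS · L1 W4.5(b) · EL♮(3)] T-DIRLIFT part D2 — THE DIRECTION CENTRE IS REGULAR: `𝒪_{X₁,y} ⧸ Γ̃_y ≅`-level identification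
# `A[I/m] ⧸ (m, ℓ/m) ≅ A ⧸ I` on the chart `m`, hence `𝒪_{X₁,y} ⧸ Γ̃_y` is a regular local ring wherever `C = V(I)` is

Crux chain w45b (cell `res-hironaka`, slot W4.5(b)), working crux **EL♮** = stmt-ResolutionOfSingularities-20038, child **EL♮(3)** =
stmt-ResolutionOfSingularities-20148, route EquisingularLift, line `sections`; registered stubs `stub_elnat_dirZeroPointResolution` (DIR₀) and
`stub_elnat_towerPointResolution` (TOWER); supplier object **T-DIRLIFT** (plan-1 CHAIN v7.24 O2; res-type-027 credited), part D2 after D1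
(…NatDirectionCentre, p547943). HONEST FRAMING: OURS; NOT a statement of any manuscript; AI-written, weaker than expert review. No `sorry`;
standard axioms. DEF-FREE. `--supports stmt-ResolutionOfSingularities-20148 --as helper`.

WHAT.
* `comap_constantCoeff_eq_map_C_sup_span_X` — in `A[T]`: the polynomials with constant term in `I` are `I·A[T] + (T)`.
* `map_eval_comap_constantCoeff_eq_span_sup` — under the presentation `eval : A[T_j : j ≠ i] → A[I/c_i]` that ideal becomes
  `(c_i/1) + (c_j/c_i : j ≠ i)` = the direction-centre ideal on the chart (for `r = 2`, `i = 1`: `(m, ℓ/m)`).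
* `nonempty_quotient_directionCentre_equiv` — **`A[I/c_i] ⧸ ((c_i) + (c_j/c_i : j ≠ i)) ≅ A ⧸ I`** (`x` quasi-regular).
* `isRegularLocalRing_quotient_map_of_equiv` (ring form: `S = B_𝔔`, `B/𝔞 ≅ R₀` regular ⇒ `S/𝔞S` regular local) and
  **`isRegularLocalRing_quotient_directionCentre`** — for a blowing up `τ : X₁ → X` along `I`, a point `y ∈ V(Γ̃)` over `x` presented on the
  chart `m = c 1` at a prime over `𝔪_x`, a frame `I_x = (ℓ, m)` (quasi-regular, `𝒪_{X,x}/I_x` a regular local ring, e.g. `C` regular at `x`)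
  and a direction `𝒟_x = (ℓ) + (m²)`: **`𝒪_{X₁,y} ⧸ Γ̃_y` is a regular local ring**, `Γ̃ = controlledTransform τ I 𝒟 1`.

References: The Stacks Project, Tags 052P, 0BIQ; Matsumura Thm. 19.3 (Serre: a regular local ring is a regular ring — tree
`isRegularRing_of_isRegularLocalRing`, AdicCompletionRegular) — through the tree (`BlowupAlgebraPresentation`: `eval`, `quotientMapEvalEquiv`,
`comap_eval_span_algebraMap_eq`; …NatNonEquimultipleStrictTransform p543997: `map_C_le_comap_constantCoeff`; …NatCarrierDeltaRegular (res-type-100):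
`isRegularLocalRing_quotient_map_of_isLocalization`; …NatDirectionCentre p547943: `stalkIdeal_directionCentre_of_chart_one`).
-/

set_option linter.dupNamespace false -- mandated namespace `Summit.<Summit>.<Problem>` of this single-conjunct summit

noncomputable section

open CategoryTheory CategoryTheory.Limits AlgebraicGeometry TopologicalSpace IsLocalRing
open Literature.AlgebraicGeometry.Resolution
open AlgebraicGeometry.Scheme.IdealSheafData

namespace Summit.ResolutionOfSingularities.ResolutionOfSingularities.Cruxes.EquisingularLiftNat.Sections

universe u

/-! ## 1. `A[T] ⊇ (polynomials with constant term in I) = I·A[T] + (T)` -/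

section Poly

variable {A : Type u} [CommRing A] {σ : Type*}

/-- A polynomial minus its constant term lies in the ideal of the variables. [folklore] -/
theorem sub_C_constantCoeff_mem_span_X (p : MvPolynomial σ A) :
    p - MvPolynomial.C (MvPolynomial.constantCoeff p) ∈ (Ideal.span (Set.range MvPolynomial.X) : Ideal (MvPolynomial σ A)) := by
  classical
  rw [← Set.image_univ, MvPolynomial.mem_ideal_span_X_image]
  intro m hm
  by_contra h
  push Not at h
  have hm0 : m = 0 := by
    ext i
    simpa using h i (Set.mem_univ i)
  subst hm0
  rw [MvPolynomial.mem_support_iff, MvPolynomial.coeff_sub, MvPolynomial.coeff_C, if_pos rfl, ← MvPolynomial.constantCoeff_eq,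
    sub_self] at hm
  exact hm rfl

/-- **The polynomials with constant term in `I` are `I·A[T] + (T)`.** [folklore] -/
theorem comap_constantCoeff_eq_map_C_sup_span_X (I : Ideal A) :
    (I.comap (MvPolynomial.constantCoeff : MvPolynomial σ A →+* A)) =
      Ideal.map (MvPolynomial.C : A →+* MvPolynomial σ A) I ⊔ Ideal.span (Set.range MvPolynomial.X) := by
  apply le_antisymm
  · intro p hp
    have h : p = MvPolynomial.C (MvPolynomial.constantCoeff p) + (p - MvPolynomial.C (MvPolynomial.constantCoeff p)) := by ring
    rw [h]
    exact Ideal.add_mem _ (Ideal.mem_sup_left (Ideal.mem_map_of_mem _ hp)) (Ideal.mem_sup_right (sub_C_constantCoeff_mem_span_X p))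
  · refine sup_le (map_C_le_comap_constantCoeff I) ?_
    rw [Ideal.span_le]
    rintro _ ⟨i, rfl⟩
    simp

end Poly

/-! ## 2. The direction-centre ideal of the chart algebra and its quotient `A ⧸ I` -/

section Chart

variable {A : Type u} [CommRing A] {r : ℕ} (x : Fin r → A) (i : Fin r)

/-- **`eval (I·A[T] + (T)) = (c_i) + (c_j/c_i : j ≠ i)`.** [cite: StacksProject, Tag 052P] -/
theorem map_eval_comap_constantCoeff_eq_span_sup :
    ((Ideal.span (Set.range x)).comap (MvPolynomial.constantCoeff : MvPolynomial {j : Fin r // j ≠ i} A →+* A)).map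
        (blowupAlgebra.eval x i).toRingHom =
      Ideal.span {algebraMap A (blowupAlgebra (Ideal.span (Set.range x)) (x i)) (x i)} ⊔
        Ideal.span (Set.range fun j : {j : Fin r // j ≠ i} => blowupAlgebra.frac x i j.1) := by
  rw [comap_constantCoeff_eq_map_C_sup_span_X, Ideal.map_sup, Ideal.map_map, eval_comp_C,
    map_blowupAlgebra_eq_span (blowupAlgebra.mem_span_range x i), Ideal.map_span, ← Set.range_comp]
  congr 2
  ext j
  simp

/-- **`A[I/c_i] ⧸ ((c_i) + (c_j/c_i : j ≠ i)) ≅ A ⧸ I`** for `x` quasi-regular: the quotient of the chart algebra by the direction-centre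
ideal (all fractions and the exceptional equation) is the coordinate ring of the centre. [cite: StacksProject, Tag 0BIQ] -/
theorem nonempty_quotient_directionCentre_equiv (hx : IsQuasiRegular x) :
    Nonempty ((blowupAlgebra (Ideal.span (Set.range x)) (x i) ⧸
        (Ideal.span {algebraMap A (blowupAlgebra (Ideal.span (Set.range x)) (x i)) (x i)} ⊔
          Ideal.span (Set.range fun j : {j : Fin r // j ≠ i} => blowupAlgebra.frac x i j.1))) ≃+*
      (A ⧸ Ideal.span (Set.range x))) := by
  -- `ker eval ≤ M := (polynomials with constant term in I)`
  have hM : RingHom.ker (blowupAlgebra.eval x i).toRingHom ≤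
      (Ideal.span (Set.range x)).comap (MvPolynomial.constantCoeff : MvPolynomial {j : Fin r // j ≠ i} A →+* A) := by
    refine le_trans ?_ (map_C_le_comap_constantCoeff _)
    rw [← blowupAlgebra.comap_eval_span_algebraMap_eq x i hx, RingHom.ker_eq_comap_bot]
    exact Ideal.comap_mono bot_le
  -- `B ⧸ eval(M) ≅ A[T] ⧸ M ≅ A ⧸ I`
  have hker : RingHom.ker ((Ideal.Quotient.mk (Ideal.span (Set.range x))).comp
      (MvPolynomial.constantCoeff : MvPolynomial {j : Fin r // j ≠ i} A →+* A)) =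
      (Ideal.span (Set.range x)).comap (MvPolynomial.constantCoeff : MvPolynomial {j : Fin r // j ≠ i} A →+* A) := by
    rw [← RingHom.comap_ker, Ideal.mk_ker]
  have hsurj : Function.Surjective ((Ideal.Quotient.mk (Ideal.span (Set.range x))).comp
      (MvPolynomial.constantCoeff : MvPolynomial {j : Fin r // j ≠ i} A →+* A)) :=
    Ideal.Quotient.mk_surjective.comp fun a => ⟨MvPolynomial.C a, MvPolynomial.constantCoeff_C _ a⟩
  refine ⟨(Ideal.quotEquivOfEq (map_eval_comap_constantCoeff_eq_span_sup x i).symm).trans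
    ((blowupAlgebra.quotientMapEvalEquiv x i hM).trans
      ((Ideal.quotEquivOfEq hker.symm).trans (RingHom.quotientKerEquivOfSurjective hsurj)))⟩

end Chart

/-! ## 3. Regularity of the direction centre -/

section Regular

/-- Ring form: `S` the localisation of `B` at a prime `𝔔 ⊇ 𝔞`, and `B ⧸ 𝔞` isomorphic to a regular ring `R₀`; then
`S ⧸ 𝔞S` is a regular local ring (localisation commutes with quotients). [cite: Matsumura1987, Thm. 19.3] -/
theorem isRegularLocalRing_quotient_map_of_equiv {B S R₀ : Type*} [CommRing B] [CommRing S] [CommRing R₀] [Algebra B S]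
    (𝔔 : Ideal B) [𝔔.IsPrime] [IsLocalization.AtPrime S 𝔔] (𝔞 : Ideal B) (h𝔞𝔔 : 𝔞 ≤ 𝔔) [IsRegularRing R₀]
    (ε : (B ⧸ 𝔞) ≃+* R₀) : IsRegularLocalRing (S ⧸ 𝔞.map (algebraMap B S)) := by
  haveI : IsRegularRing (B ⧸ 𝔞) := IsRegularRing.of_ringEquiv ε.symm
  haveI : (𝔔.map (Ideal.Quotient.mk 𝔞)).IsPrime :=
    Ideal.map_isPrime_of_surjective Ideal.Quotient.mk_surjective (by rw [Ideal.mk_ker]; exact h𝔞𝔔)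
  exact isRegularLocalRing_quotient_map_of_isLocalization 𝔔 𝔞 h𝔞𝔔 inferInstance

variable {X₁ X : Scheme.{u}} {τ : X₁ ⟶ X} {I : X.IdealSheafData}

/-- **The direction centre is regular.** `τ : X₁ → X` a blowing up along `I`, `y ∈ V(Γ̃)` over `x` presented on the chart `m = c 1` at a
prime `𝔔` over `𝔪_x`, `I_x = (c 0, c 1)` quasi-regular with `𝒪_{X,x}/I_x` a REGULAR LOCAL ring (`C` regular at `x`), and a direction
`𝒟_x = (c 0) + (c 1 · c 1)`. Then `𝒪_{X₁,y} ⧸ Γ̃_y` is a regular local ring, `Γ̃ = controlledTransform τ I 𝒟 1`: by D1 `Γ̃_y` is the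
extension of the chart ideal `𝔞 = (m, ℓ/m)`, and `A[I/m]/𝔞 ≅ A/I` is a regular ring (Serre), so its localisation at `𝔔/𝔞` is regular local.
[cite: Matsumura1987, Thm. 19.3; StacksProject, Tag 0BIQ] -/
theorem isRegularLocalRing_quotient_directionCentre (hτ : IsBlowup τ I) (𝒟 : X.IdealSheafData) (y : X₁) {x : X} (hy : τ y = x)
    (c : Fin 2 → X.presheaf.stalk x) (hc : Ideal.span (Set.range c) = stalkIdeal I x) (hqr : IsQuasiRegular c)
    [IsRegularLocalRing (X.presheaf.stalk x ⧸ Ideal.span (Set.range c))]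
    (h𝒟 : stalkIdeal 𝒟 x = Ideal.span {c 0} ⊔ Ideal.span {c 1 * c 1})
    (𝔔 : PrimeSpectrum (blowupAlgebra (Ideal.span (Set.range c)) (c 1)))
    (χ : blowupAlgebra (Ideal.span (Set.range c)) (c 1) →+* X₁.presheaf.stalk y)
    (hχ : ∀ a, χ (algebraMap _ _ a) = ((X.presheaf.stalkCongr (.of_eq hy)).inv ≫ τ.stalkMap y).hom a)
    (hloc : @IsLocalization.AtPrime _ _ (X₁.presheaf.stalk y) _ χ.toAlgebra 𝔔.asIdeal _)
    (hyΓ : y ∈ (controlledTransform τ I 𝒟 1).support) :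
    IsRegularLocalRing (X₁.presheaf.stalk y ⧸ stalkIdeal (controlledTransform τ I 𝒟 1) y) := by
  classical
  letI := χ.toAlgebra
  haveI : IsLocalization.AtPrime (X₁.presheaf.stalk y) 𝔔.asIdeal := hloc
  -- the chart ideal `𝔞 = (m, ℓ/m)`, `Γ̃_y = 𝔞·𝒪_y`
  set 𝔞 : Ideal (blowupAlgebra (Ideal.span (Set.range c)) (c 1)) :=
    Ideal.span {algebraMap _ (blowupAlgebra (Ideal.span (Set.range c)) (c 1)) (c 1)} ⊔
      Ideal.span (Set.range fun j : {j : Fin 2 // j ≠ 1} => blowupAlgebra.frac c 1 j.1) with h𝔞def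
  have hfr : (Set.range fun j : {j : Fin 2 // j ≠ 1} => blowupAlgebra.frac c 1 j.1) = {blowupAlgebra.frac c 1 0} := by
    ext b
    simp only [Set.mem_range, Set.mem_singleton_iff]
    constructor
    · rintro ⟨⟨j, hj⟩, rfl⟩
      have : j = 0 := by omega
      subst this; rfl
    · rintro rfl; exact ⟨⟨0, by omega⟩, rfl⟩
  obtain ⟨-, hΓ⟩ := stalkIdeal_directionCentre_of_chart_one hτ 𝒟 y hy c hc h𝒟 χ hχ
  have hΓ𝔞 : stalkIdeal (controlledTransform τ I 𝒟 1) y = 𝔞.map (algebraMap _ (X₁.presheaf.stalk y)) := by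
    rw [hΓ, h𝔞def, hfr, Ideal.map_sup, Ideal.map_span, Ideal.map_span, Set.image_singleton, Set.image_singleton, ← hχ]
    rfl
  -- `𝔞 ≤ 𝔔`: `Γ̃_y ≤ 𝔪_y` (the point lies on the centre) read back on the chart algebra
  have hΓle : stalkIdeal (controlledTransform τ I 𝒟 1) y ≤ maximalIdeal _ := (mem_support_iff_stalkIdeal_le _ _).mp hyΓ
  have h𝔞𝔔 : 𝔞 ≤ 𝔔.asIdeal := by
    intro b hb
    rw [mem_chartPrime_iff_apply_mem_maximalIdeal 𝔔 χ hloc]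
    apply hΓle
    rw [hΓ𝔞]
    exact Ideal.mem_map_of_mem _ hb
  -- `A[I/m]/𝔞 ≅ A/I` with `A/I` a regular ring (Serre); localisation commutes with quotients
  haveI : IsRegularRing (X.presheaf.stalk x ⧸ Ideal.span (Set.range c)) :=
    Literature.AlgebraicGeometry.Resolution.isRegularRing_of_isRegularLocalRing _
  obtain ⟨ε⟩ := nonempty_quotient_directionCentre_equiv c 1 hqr
  rw [hΓ𝔞]
  exact isRegularLocalRing_quotient_map_of_equiv (S := X₁.presheaf.stalk y) 𝔔.asIdeal 𝔞 h𝔞𝔔 ε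

end Regular

end Summit.ResolutionOfSingularities.ResolutionOfSingularities.Cruxes.EquisingularLiftNat.Sections

end
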